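import Mathlib
import HarnessLib
import Summits.Ventures.LatticeQCDFlow.Scoring.ChainSampleSize
import Summits.Ventures.LatticeQCDFlow.Scoring.FlowSamplerAutocorrelation

/-!
# Run length of the exact flow sampler from its flow-equation defect — UNCONDITIONAL on `SU(n)^E`:
# `N ≥ 8C'e^{2δ}/s` and `N ≥ 32 C'² e^{4δ} log(2/η)/s²` updates certify `P(|A_N − πf| > s) ≤ η`

HONEST FRAMING: exact (Metropolis-corrected) sampling algorithms for lattice gauge theory;
figures of merit are autocorrelation/cost numbers at stated couplings and volumes; no
continuum-physics claim.

Venture `LatticeQCDFlow` (cell pub-lqcd), topic `Scoring`; FANOUT row 8 (`s0-cpn-nemc`, GEN-13).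
NEW WORK of the cell, not a published result; no definition is introduced.  The composition of
`Scoring/ChainSampleSize.lean` (`chain_sampleSize_of_doeblin`; any initial law) with the tree's exact flow-MCMC theorem `Exactness.flowSampler_exact_doeblin`
(row 30 / lean-2, UNCONDITIONAL via `jacobianFormula_holds`: Doeblin constant `e^{−2δ}` from a
uniform defect `δ` of Lüscher's flow equation).  Nothing is cited as a fact.

## Content (hypotheses of `Scoring.flowSampler_autocorrelation`; `K = indepMH q w` EXACT for
## `π = 𝒵⁻¹e^{−S}D[U]`; `μ₀` ANY initial law; `|f| ≤ C`, `C' = C + |πf|`)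

* **`flowSampler_runLength`** — `s > 0`, `0 < η ≤ 1`, `N ≥ 1`, `8C'e^{2δ}/s ≤ N` and
  `32 C'² e^{4δ} log(2/η)/s² ≤ N` ⇒ `P_{μ₀}(|(1/N) Σ_{i<N} f(U_i) − πf| > s) ≤ η`
  (the simultaneous version for `k` observables is `chain_simultaneous_confidence_of_doeblin` with
  `ε = e^{−2δ}`, not restated).

Reading (value-free): a certified defect `δ` converts a target precision and confidence for any
bounded observable into an explicit number of exact-sampler updates, from a cold start, at every
volume at which `δ` holds; the volume / coupling dependence of that number is exactly that of
`e^{2δ}` and `e^{4δ}` (theory-1's subject).  NOT CLAIMED: any value of `δ`; necessity of these run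
lengths; unbounded observables.
-/

noncomputable section

namespace Summit.Ventures.LatticeQCDFlow.Scoring

open MeasureTheory ProbabilityTheory Filter Finset Preorder Summit.Ventures.LatticeQCDFlow.Exactness
open Literature.MathematicalPhysics.QuantumFieldTheory
open Literature.MathematicalPhysics.QuantumFieldTheory.Luscher2010
open Summit.Ventures.LatticeQCDFlow.TrivializingMaps
open scoped ENNReal Matrix Matrix.Norms.Frobenius ContDiff

variable {d L n : ℕ} [NeZero L]

/-- **Run length of the exact flow sampler — UNCONDITIONAL, any start.**  See the module docstring. -/
theorem flowSampler_runLength (B : SuBasis n)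
    {S : AmbConfig d L n → ℝ} (hS : ContDiff ℝ ∞ S) {F : ℝ → AmbConfig d L n → ℝ}
    (hF : ContDiff ℝ ∞ fun p : ℝ × AmbConfig d L n => F p.1 p.2)
    {Φ : ℝ → GaugeConfig d L (Matrix.specialUnitaryGroup (Fin n) ℂ) →
      GaugeConfig d L (Matrix.specialUnitaryGroup (Fin n) ℂ)}
    (hΦ : IsFlowMap (fun t W => -linkGrad B (F t) W) Φ) {c : ℝ → ℝ} {δ : ℝ}
    (hδ : ∀ t ∈ Set.Icc (0 : ℝ) 1, ∀ U : GaugeConfig d L (Matrix.specialUnitaryGroup (Fin n) ℂ),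
      |luscherL B S t (F t) (WilsonFlow.coeConfig U) - S (WilsonFlow.coeConfig U) - c t| ≤ δ)
    (q : Measure (GaugeConfig d L (Matrix.specialUnitaryGroup (Fin n) ℂ))) [IsProbabilityMeasure q]
    (hq : q = Measure.map (Φ 1) (trivialMeasure (Matrix.specialUnitaryGroup (Fin n) ℂ) d L)) :
    ∃ w : GaugeConfig d L (Matrix.specialUnitaryGroup (Fin n) ℂ) → ℝ, ∃ hw : Measurable w,
      (q.withDensity fun U => ENNReal.ofReal (w U)) =
        boltzmannMeasure (fun U : GaugeConfig d L (Matrix.specialUnitaryGroup (Fin n) ℂ) =>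
          S (WilsonFlow.coeConfig U)) ∧
      Kernel.Invariant (indepMH q w)
        (boltzmannMeasure fun U : GaugeConfig d L (Matrix.specialUnitaryGroup (Fin n) ℂ) =>
          S (WilsonFlow.coeConfig U)) ∧
      ∀ (μ₀ : Measure (GaugeConfig d L (Matrix.specialUnitaryGroup (Fin n) ℂ))) [IsProbabilityMeasure μ₀]
        (f : GaugeConfig d L (Matrix.specialUnitaryGroup (Fin n) ℂ) → ℝ), Measurable f →
        ∀ C : ℝ, (∀ U, |f U| ≤ C) → ∀ N : ℕ, N ≠ 0 → ∀ s η : ℝ, 0 < s → 0 < η → η ≤ 1 →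
        let π := boltzmannMeasure fun U : GaugeConfig d L (Matrix.specialUnitaryGroup (Fin n) ℂ) =>
          S (WilsonFlow.coeConfig U)
        8 * (C + |∫ V, f V ∂π|) * Real.exp (2 * δ) / s ≤ N →
        32 * (C + |∫ V, f V ∂π|) ^ 2 * Real.exp (4 * δ) * Real.log (2 / η) / s ^ 2 ≤ N →
        haveI : Fact (Measurable w) := ⟨hw⟩
        (Kernel.trajMeasure (X := fun _ : ℕ => GaugeConfig d L (Matrix.specialUnitaryGroup (Fin n) ℂ))
              μ₀ (fun m : ℕ => (indepMH q w).comap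
                (fun y : (i : ↥(Finset.Iic m)) → GaugeConfig d L (Matrix.specialUnitaryGroup (Fin n) ℂ) =>
                  y ⟨m, Finset.mem_Iic.2 le_rfl⟩) (measurable_pi_apply _))).real
            {x | s < |(∑ i ∈ Finset.range N, f (x i)) / N - ∫ V, f V ∂π|}
          ≤ η := by
  obtain ⟨w, hw, -, -, hπ, hinv, -, hdoeb⟩ := flowSampler_exact_doeblin B hS hF hΦ hδ q hq
  haveI : Fact (Measurable w) := ⟨hw⟩
  have hS'c : Continuous fun U : GaugeConfig d L (Matrix.specialUnitaryGroup (Fin n) ℂ) =>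
      S (WilsonFlow.coeConfig U) := hS.continuous.comp WilsonFlow.continuous_coeConfig
  haveI := isProbabilityMeasure_boltzmannMeasure (d := d) (L := L) hS'c
  have hε0 : 0 < ENNReal.ofReal (Real.exp (-(2 * δ))) := ENNReal.ofReal_pos.2 (Real.exp_pos _)
  refine ⟨w, hw, hπ, hinv, fun μ₀ _ f hf C hC N hN s η hs hη0 hη1 hN1 hN2 => ?_⟩
  have hr : (ENNReal.ofReal (Real.exp (-(2 * δ)))).toReal = Real.exp (-(2 * δ)) :=
    ENNReal.toReal_ofReal (Real.exp_pos _).le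
  set Cp := C + |∫ V, f V ∂(boltzmannMeasure fun U : GaugeConfig d L
        (Matrix.specialUnitaryGroup (Fin n) ℂ) => S (WilsonFlow.coeConfig U))| with hCp
  have he0 : Real.exp (2 * δ) ≠ 0 := (Real.exp_pos _).ne'
  have hq1 : 8 * Cp / ((ENNReal.ofReal (Real.exp (-(2 * δ)))).toReal * s)
      = 8 * Cp * Real.exp (2 * δ) / s := by
    rw [hr, Real.exp_neg]
    field_simp
  have hq2 : 32 * Cp ^ 2 * Real.log (2 / η) / ((ENNReal.ofReal (Real.exp (-(2 * δ)))).toReal ^ 2 * s ^ 2)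
      = 32 * Cp ^ 2 * Real.exp (4 * δ) * Real.log (2 / η) / s ^ 2 := by
    have h4 : Real.exp (4 * δ) = Real.exp (2 * δ) ^ 2 := by
      rw [← Real.exp_nat_mul]; ring_nf
    rw [hr, Real.exp_neg, h4]
    field_simp
  have hN1' : 8 * Cp / ((ENNReal.ofReal (Real.exp (-(2 * δ)))).toReal * s) ≤ N := by
    rw [hq1]; exact hN1
  have hN2' : 32 * Cp ^ 2 * Real.log (2 / η)
      / ((ENNReal.ofReal (Real.exp (-(2 * δ)))).toReal ^ 2 * s ^ 2) ≤ N := by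
    rw [hq2]; exact hN2
  exact chain_sampleSize_of_doeblin (κ := indepMH q w) (μ₀ := μ₀) hinv (fun x B hB => hdoeb x hB)
    hε0 hf hC hN hs hη0 hη1 hN1' hN2'

end Summit.Ventures.LatticeQCDFlow.Scoring

end
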